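import Literature.ModelTheory.ExponentialFields.Wilkie1989Branches
import Literature.ModelTheory.ExponentialFields.Wilkie1989Khovanskii
import HarnessLib

/-!
# Wilkie 1989, §5: Lemmas 4 and 6 "can be expressed as first-order sentences" — transfer to the models of `T_exp`

Trunk `TranscendEllArithS`, family `periods` (periods.S28): towards the leaf
`Literature.ModelTheory.ExponentialFields.Wilkie1989_expAlgebraicPoints_mem` of the decomposition of
`Literature.ModelTheory.ExponentialFields.wilkie_isModelComplete`, following A. J. Wilkie, *On the
theory of the real exponential field*, Illinois J. Math. 33 (1989), p. 403: "It thus follows that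
Lemmas 4 and 6 can be expressed as first-order sentences of `L` (in the case `g₁, …, gₙ₋₁, g` are
terms) uniformly in the parameters occurring in the `g`'s", and p. 405: "We are now in a position
to apply Lemma 4 (using transfer—see the remarks at the end of Section 5)".

For a system of terms `c₁, …, cₘ` (the curve equations, parameters `κ`, variables
`x₁, …, xₘ₊₁`) and a term `h`, this file builds the first-order formulas expressing Lemma 6 and
Lemma 4 in the parameters and the real quantities `B, c, d` resp. `B, β₁`
(`CurveTransfer.lemma6F`, `CurveTransfer.lemma4F`), computes their realizations in any lawful
structure (`realize_lemma6F`, `realize_lemma4F`: the semantic statements `Lemma6Sem`, `Lemma4Sem`,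
phrased with coordinates and absolute values so that they make sense in every ordered exponential
field), proves them in `ℝ` from the real lemmas (`Wilkie1989_lemma6`, `Wilkie1989_lemma4` of
`Wilkie1989Branches.lean` — no finiteness theorem of Khovanskii is needed, since the real Lemma 4
was proved there without the hypothesis on connected components), and transfers
them to every model `K` of `T_exp` (`lemma6Sem_model`, `lemma4Sem_model`).  Counting
("contains exactly `r` points", "the number of zeroes … is given by") uses the counting formulas
`RealExpModel.exactCardF` of `Wilkie1989Khovanskii.lean`; the sign of Wilkie's `g*` is the sign of
the product of the two Jacobian determinants (`CurveTransfer.fullDetT`, `tailDetT`).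

## References

* A. J. Wilkie, *On the theory of the real exponential field*, Illinois J. Math. 33 (1989),
  384–408: §5, pp. 399–403; §6, pp. 405–407.
-/

noncomputable section

open FirstOrder FirstOrder.Language FirstOrder.Language.Structure
open Set

namespace Literature.ModelTheory.ExponentialFields

namespace CurveTransfer

open RealExpModel

variable {κ W α : Type} {m : ℕ}

/-! ### Absolute values in formulas -/

/-- `|t| < B` as a formula. [folklore] -/
def absLtF (t B : Language.orderedExpRing.Term α) : Language.orderedExpRing.Formula α :=
  ExpFormula.lt (-B) t ⊓ ExpFormula.lt t B

/-- `|t| ≤ B` as a formula. [folklore] -/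
def absLeF (t B : Language.orderedExpRing.Term α) : Language.orderedExpRing.Formula α :=
  ExpFormula.le (-B) t ⊓ ExpFormula.le t B

/-- `B < |t|` as a formula. [folklore] -/
def absGtF (B t : Language.orderedExpRing.Term α) : Language.orderedExpRing.Formula α :=
  ExpFormula.lt B t ⊔ ExpFormula.lt B (-t)

/-- `t = B ∨ t = -B` (i.e. `|t| = B` when `B ≥ 0`) as a formula. [folklore] -/
def absEqF (t B : Language.orderedExpRing.Term α) : Language.orderedExpRing.Formula α :=
  ExpFormula.eq t B ⊔ ExpFormula.eq t (-B)

variable {M : Type*} [Language.orderedExpRing.Structure M] [Field M] [LinearOrder M]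
  [IsStrictOrderedRing M] [LawfulStructure M]

/-- Realization of `absLtF`. [folklore] -/
@[simp] theorem realize_absLtF (t B : Language.orderedExpRing.Term α) (v : α → M) :
    (absLtF t B).Realize v ↔ |t.realize v| < B.realize v := by
  simp [absLtF, abs_lt]

/-- Realization of `absLeF`. [folklore] -/
@[simp] theorem realize_absLeF (t B : Language.orderedExpRing.Term α) (v : α → M) :
    (absLeF t B).Realize v ↔ |t.realize v| ≤ B.realize v := by
  simp [absLeF, abs_le]

omit [IsStrictOrderedRing M] in
/-- Realization of `absGtF`. [folklore] -/
@[simp] theorem realize_absGtF (B t : Language.orderedExpRing.Term α) (v : α → M) :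
    (absGtF B t).Realize v ↔ B.realize v < |t.realize v| := by
  simp [absGtF, lt_abs]

omit [IsStrictOrderedRing M] in
/-- Realization of `absEqF`. [folklore] -/
@[simp] theorem realize_absEqF (t B : Language.orderedExpRing.Term α) (v : α → M) :
    (absEqF t B).Realize v ↔ t.realize v = B.realize v ∨ t.realize v = -B.realize v := by
  simp [absEqF]

/-! ### Terms at the point: parameters through an embedding of variable contexts -/

/-- A term in the parameters `κ` and the point variables `x₁, …, xₘ₊₁`, read in a larger context
`W ⊕ Fin (m + 1)` through `ι : κ → W`. [folklore] -/
def atPt (ι : κ → W) (s : Language.orderedExpRing.Term (κ ⊕ Fin (m + 1))) :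
    Language.orderedExpRing.Term (W ⊕ Fin (m + 1)) :=
  s.relabel (Sum.map ι _root_.id)

omit [Field M] [LinearOrder M] [IsStrictOrderedRing M] [LawfulStructure M] in
/-- Realization of `atPt`. [folklore] -/
@[simp] theorem realize_atPt (ι : κ → W) (s : Language.orderedExpRing.Term (κ ⊕ Fin (m + 1)))
    (w : W → M) (x : Fin (m + 1) → M) :
    (atPt ι s).realize (Sum.elim w x) = s.realize (Sum.elim (w ∘ ι) x) := by
  rw [atPt, Term.realize_relabel, Sum.elim_comp_map, Function.comp_id]

/-- "`x̄ ∈ V(c₁, …, cₘ)`" as a formula in the context `W ⊕ Fin (m + 1)`. [folklore] -/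
def inVF (ι : κ → W) (c : Fin m → Language.orderedExpRing.Term (κ ⊕ Fin (m + 1))) :
    Language.orderedExpRing.Formula (W ⊕ Fin (m + 1)) :=
  Formula.iInf fun r => ExpFormula.eq (atPt ι (c r)) 0

omit [IsStrictOrderedRing M] in
/-- Realization of `inVF`. [folklore] -/
@[simp] theorem realize_inVF (ι : κ → W) (c : Fin m → Language.orderedExpRing.Term (κ ⊕ Fin (m + 1)))
    (w : W → M) (x : Fin (m + 1) → M) :
    (inVF ι c).Realize (Sum.elim w x) ↔ ∀ r, (c r).realize (Sum.elim (w ∘ ι) x) = 0 := by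
  simp [inVF]

/-- "`|xᵢ₊₁| ≤ B` for all `i`" (the point's tail lies in `Ū_B`) as a formula. [folklore] -/
def tailLeF (B : Language.orderedExpRing.Term W) : Language.orderedExpRing.Formula (W ⊕ Fin (m + 1)) :=
  Formula.iInf fun i : Fin m => absLeF (var (Sum.inr i.succ)) (B.relabel Sum.inl)

/-- "`|xᵢ₊₁| < B` for all `i`" (the point's tail lies in `U_B`) as a formula. [folklore] -/
def tailLtF (B : Language.orderedExpRing.Term W) : Language.orderedExpRing.Formula (W ⊕ Fin (m + 1)) :=
  Formula.iInf fun i : Fin m => absLtF (var (Sum.inr i.succ)) (B.relabel Sum.inl)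

/-- Realization of `tailLeF`. [folklore] -/
@[simp] theorem realize_tailLeF (B : Language.orderedExpRing.Term W) (w : W → M) (x : Fin (m + 1) → M) :
    (tailLeF (m := m) B).Realize (Sum.elim w x) ↔ ∀ i : Fin m, |x i.succ| ≤ B.realize w := by
  simp [tailLeF]

/-- Realization of `tailLtF`. [folklore] -/
@[simp] theorem realize_tailLtF (B : Language.orderedExpRing.Term W) (w : W → M) (x : Fin (m + 1) → M) :
    (tailLtF (m := m) B).Realize (Sum.elim w x) ↔ ∀ i : Fin m, |x i.succ| < B.realize w := by
  simp [tailLtF]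

/-- The tail Jacobian determinant `det (∂cᵢ/∂xⱼ₊₁)` as a term. [cite: Wilkie1989, Lemma 4] -/
def tailDetT (c : Fin m → Language.orderedExpRing.Term (κ ⊕ Fin (m + 1))) :
    Language.orderedExpRing.Term (κ ⊕ Fin (m + 1)) :=
  ExpTerm.det (Matrix.of fun i j => termPDeriv j.succ (c i))

/-- The full Jacobian determinant `det ∂(h, c₁, …, cₘ)/∂(x₁, …, xₘ₊₁)` as a term (row of `h`
first, as in `SpaceCurve.fullJacobian`). [cite: Wilkie1989, Lemma 6] -/
def fullDetT (c : Fin m → Language.orderedExpRing.Term (κ ⊕ Fin (m + 1)))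
    (h : Language.orderedExpRing.Term (κ ⊕ Fin (m + 1))) :
    Language.orderedExpRing.Term (κ ⊕ Fin (m + 1)) :=
  ExpTerm.det (Matrix.of (Fin.cons (fun j => termPDeriv j h) fun i j => termPDeriv j (c i)))

/-! ### Sums of counts -/

/-- "the numbers of solutions of `φ₀, …, φ₄` add up to `r`" as a formula: a finite disjunction over
the decompositions `r = n₀ + ⋯ + n₄` of conjunctions of `exactCardF`. [folklore] -/
def sumCardF {n : ℕ} (φ : Fin 5 → Language.orderedExpRing.Formula (α ⊕ Fin n)) (r : ℕ) :
    Language.orderedExpRing.Formula α :=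
  Formula.iSup fun ν : {ν : Fin 5 → Fin (r + 1) // ∑ i, (ν i : ℕ) = r} =>
    Formula.iInf fun i : Fin 5 => exactCardF (φ i) (ν.1 i)

omit [Field M] [IsStrictOrderedRing M] [LawfulStructure M] in
/-- Realization of `sumCardF`: the (extended) cardinalities of the solution sets add up to `r`.
[folklore] -/
theorem realize_sumCardF {n : ℕ} (φ : Fin 5 → Language.orderedExpRing.Formula (α ⊕ Fin n)) (r : ℕ)
    (v : α → M) :
    (sumCardF φ r).Realize v ↔ ∑ i, {x : Fin n → M | (φ i).Realize (Sum.elim v x)}.encard = r := by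
  simp only [sumCardF, Formula.realize_iSup, Formula.realize_iInf, realize_exactCardF]
  constructor
  · rintro ⟨⟨ν, hν⟩, h⟩
    rw [Finset.sum_congr rfl fun i _ => h i]
    push_cast
    exact_mod_cast hν
  · intro h
    have hfin : ∀ i, {x : Fin n → M | (φ i).Realize (Sum.elim v x)}.encard ≠ ⊤ := by
      intro i htop
      have hle : {x : Fin n → M | (φ i).Realize (Sum.elim v x)}.encard ≤
          ∑ j, {x : Fin n → M | (φ j).Realize (Sum.elim v x)}.encard :=
        Finset.single_le_sum (f := fun j => {x : Fin n → M | (φ j).Realize (Sum.elim v x)}.encard)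
          (fun j _ => by simp) (Finset.mem_univ i)
      rw [htop, h, top_le_iff] at hle
      exact ENat.coe_ne_top r hle
    set nn : Fin 5 → ℕ := fun i => ({x : Fin n → M | (φ i).Realize (Sum.elim v x)}.encard).toNat with hnn
    have hnn' : ∀ i, {x : Fin n → M | (φ i).Realize (Sum.elim v x)}.encard = nn i :=
      fun i => (ENat.coe_toNat (hfin i)).symm
    have hsum : ∑ i, nn i = r := by
      have : (∑ i, (nn i : ℕ∞)) = r := by rw [← h]; exact Finset.sum_congr rfl fun i _ => (hnn' i).symm
      exact_mod_cast this
    have hlt : ∀ i, nn i < r + 1 := fun i => by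
      have := Finset.single_le_sum (f := nn) (fun j _ => Nat.zero_le _) (Finset.mem_univ i)
      omega
    exact ⟨⟨fun i => ⟨nn i, hlt i⟩, by simpa using hsum⟩, fun i => hnn' i⟩

omit [Field M] [IsStrictOrderedRing M] [LawfulStructure M] in
/-- Realization of `sumCardF` for five explicitly listed formulas. [folklore] -/
@[simp] theorem realize_sumCardF_five {n : ℕ} (φ₀ φ₁ φ₂ φ₃ φ₄ : Language.orderedExpRing.Formula (α ⊕ Fin n))
    (r : ℕ) (v : α → M) :
    (sumCardF ![φ₀, φ₁, φ₂, φ₃, φ₄] r).Realize v ↔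
      {x : Fin n → M | φ₀.Realize (Sum.elim v x)}.encard + {x | φ₁.Realize (Sum.elim v x)}.encard +
        {x | φ₂.Realize (Sum.elim v x)}.encard + {x | φ₃.Realize (Sum.elim v x)}.encard +
        {x | φ₄.Realize (Sum.elim v x)}.encard = r := by
  rw [realize_sumCardF, Fin.sum_univ_five]
  rfl

omit [Language.orderedExpRing.Structure M] [Field M] [LinearOrder M] [IsStrictOrderedRing M]
  [LawfulStructure M] in
/-- Normalization of parameter valuations read through nested variable contexts. [folklore] -/
@[simp] theorem elim_comp_inl_comp {β γ : Type*} (v : α → M) (w : β → M) (f : γ → α) :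
    ((fun a => Sum.elim v w a) ∘ (Sum.inl ∘ f)) = v ∘ f := rfl

/-! ### Lemma 6 as a first-order formula -/

section Lemma6F

/-- **Lemma 6 as a first-order formula** in the parameters `κ` of the terms and the three real
quantities `B, c, d` (free variables `Fin 3`, in this order): hypotheses "tail determinant
non-vanishing on `V`", "`0 < B`, `c < d`", "exactly `r` points in the fibre over every
`a ∈ [c, d]` inside `Ū_B`", "`V ∩ ({a} × U_B) = V ∩ ({a} × Ū_{B+1})` for `a ∈ (c, d)`", "full
determinant non-vanishing on `V`" (i.e. `g* ≠ 0`), and conclusion "the numbers of points of the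
five sets add up to `r`" (p. 403: "Lemmas 4 and 6 can be expressed as first-order sentences of `L`
… uniformly in the parameters"). [cite: Wilkie1989, §5, p. 403] -/
def lemma6F (c : Fin m → Language.orderedExpRing.Term (κ ⊕ Fin (m + 1)))
    (h : Language.orderedExpRing.Term (κ ⊕ Fin (m + 1))) (r : ℕ) :
    Language.orderedExpRing.Formula (κ ⊕ Fin 3) :=
  let W := κ ⊕ Fin 3
  let ι : κ → W := Sum.inl
  let B : Language.orderedExpRing.Term W := var (Sum.inr 0)
  let cc : Language.orderedExpRing.Term W := var (Sum.inr 1)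
  let dd : Language.orderedExpRing.Term W := var (Sum.inr 2)
  let hyp1 : Language.orderedExpRing.Formula W :=
    Formula.iAlls (Fin (m + 1)) (inVF ι c ⟹ (ExpFormula.eq (atPt ι (tailDetT c)) 0).not)
  let hyp2 : Language.orderedExpRing.Formula W := ExpFormula.lt 0 B ⊓ ExpFormula.lt cc dd
  let W₁ := W ⊕ Fin 1
  let ι₁ : κ → W₁ := Sum.inl ∘ Sum.inl
  let a : Language.orderedExpRing.Term W₁ := var (Sum.inr 0)
  let B₁ : Language.orderedExpRing.Term W₁ := B.relabel Sum.inl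
  let fib : Language.orderedExpRing.Formula (W₁ ⊕ Fin (m + 1)) :=
    inVF ι₁ c ⊓ ExpFormula.eq (var (Sum.inr 0)) (a.relabel Sum.inl) ⊓ tailLeF B₁
  let hyp3 : Language.orderedExpRing.Formula W :=
    Formula.iAlls (Fin 1)
      ((ExpFormula.le (cc.relabel Sum.inl) a ⊓ ExpFormula.le a (dd.relabel Sum.inl)) ⟹ exactCardF fib r)
  let hyp4 : Language.orderedExpRing.Formula W :=
    Formula.iAlls (Fin 1)
      ((ExpFormula.lt (cc.relabel Sum.inl) a ⊓ ExpFormula.lt a (dd.relabel Sum.inl)) ⟹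
        Formula.iAlls (Fin (m + 1))
          ((inVF ι₁ c ⊓ ExpFormula.eq (var (Sum.inr 0)) (a.relabel Sum.inl)) ⟹
            (tailLtF B₁ ⇔ tailLeF (B₁ + 1))))
  let hyp5 : Language.orderedExpRing.Formula W :=
    Formula.iAlls (Fin (m + 1)) (inVF ι c ⟹ (ExpFormula.eq (atPt ι (fullDetT c h)) 0).not)
  let base : Language.orderedExpRing.Formula (W ⊕ Fin (m + 1)) := inVF ι c ⊓ tailLeF B
  let x0 : Language.orderedExpRing.Term (W ⊕ Fin (m + 1)) := var (Sum.inr 0)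
  let hx : Language.orderedExpRing.Term (W ⊕ Fin (m + 1)) := atPt ι h
  let pr : Language.orderedExpRing.Term (W ⊕ Fin (m + 1)) :=
    atPt ι (fullDetT c h) * atPt ι (tailDetT c)
  let ccx : Language.orderedExpRing.Term (W ⊕ Fin (m + 1)) := cc.relabel Sum.inl
  let ddx : Language.orderedExpRing.Term (W ⊕ Fin (m + 1)) := dd.relabel Sum.inl
  let Z := base ⊓ ExpFormula.le ccx x0 ⊓ ExpFormula.le x0 ddx ⊓ ExpFormula.eq hx 0
  let S1 := base ⊓ ExpFormula.eq x0 ccx ⊓ ExpFormula.lt 0 hx ⊓ ExpFormula.lt 0 pr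
  let S2 := base ⊓ ExpFormula.eq x0 ccx ⊓ ExpFormula.lt hx 0 ⊓ ExpFormula.lt pr 0
  let S3 := base ⊓ ExpFormula.eq x0 ddx ⊓ ExpFormula.lt 0 hx ⊓ ExpFormula.lt pr 0
  let S4 := base ⊓ ExpFormula.eq x0 ddx ⊓ ExpFormula.lt hx 0 ⊓ ExpFormula.lt 0 pr
  (hyp1 ⊓ hyp2 ⊓ hyp3 ⊓ hyp4 ⊓ hyp5) ⟹ sumCardF ![Z, S1, S2, S3, S4] r

/-- **The semantic content of `lemma6F`** in a lawful ordered structure `M` (parameters `a`,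
quantities `B, c, d`): Lemma 6 for the functions defined by the terms, with points written
`(t, ȳ)`, the boxes by coordinate bounds, the counts by `Set.encard`, and the sign of `g*` as the
sign of the product of the two Jacobian determinants.  (The shape of this statement is the one
produced by unfolding the formula, `realize_lemma6F`.) [cite: Wilkie1989, §5, p. 403] -/
def Lemma6Sem (c : Fin m → Language.orderedExpRing.Term (κ ⊕ Fin (m + 1)))
    (h : Language.orderedExpRing.Term (κ ⊕ Fin (m + 1))) (a : κ → M) (B cc dd : M) (r : ℕ) : Prop :=
  (((((∀ (t : M) (y : Fin m → M), (∀ i, (c i).realize (Sum.elim a (Fin.cons t y)) = 0) →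
            ¬ (tailDetT c).realize (Sum.elim a (Fin.cons t y)) = 0) ∧
          0 < B ∧ cc < dd) ∧
        ∀ t : M, cc ≤ t ∧ t ≤ dd →
          {x : Fin (m + 1) → M | ((∀ i, (c i).realize (Sum.elim a x) = 0) ∧ x 0 = t) ∧
            ∀ i : Fin m, |x i.succ| ≤ B}.encard = r) ∧
      ∀ t : M, cc < t ∧ t < dd → ∀ (s : M) (y : Fin m → M),
        (∀ i, (c i).realize (Sum.elim a (Fin.cons s y)) = 0) ∧ s = t →
          ((∀ i : Fin m, |y i| < B) ↔ ∀ i : Fin m, |y i| ≤ B + 1)) ∧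
    ∀ (t : M) (y : Fin m → M), (∀ i, (c i).realize (Sum.elim a (Fin.cons t y)) = 0) →
      ¬ (fullDetT c h).realize (Sum.elim a (Fin.cons t y)) = 0) →
  {x : Fin (m + 1) → M | ((((∀ i, (c i).realize (Sum.elim a x) = 0) ∧ ∀ i : Fin m, |x i.succ| ≤ B) ∧
        cc ≤ x 0) ∧ x 0 ≤ dd) ∧ h.realize (Sum.elim a x) = 0}.encard +
    {x : Fin (m + 1) → M | ((((∀ i, (c i).realize (Sum.elim a x) = 0) ∧ ∀ i : Fin m, |x i.succ| ≤ B) ∧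
        x 0 = cc) ∧ 0 < h.realize (Sum.elim a x)) ∧
        0 < (fullDetT c h).realize (Sum.elim a x) * (tailDetT c).realize (Sum.elim a x)}.encard +
    {x : Fin (m + 1) → M | ((((∀ i, (c i).realize (Sum.elim a x) = 0) ∧ ∀ i : Fin m, |x i.succ| ≤ B) ∧
        x 0 = cc) ∧ h.realize (Sum.elim a x) < 0) ∧
        (fullDetT c h).realize (Sum.elim a x) * (tailDetT c).realize (Sum.elim a x) < 0}.encard +
    {x : Fin (m + 1) → M | ((((∀ i, (c i).realize (Sum.elim a x) = 0) ∧ ∀ i : Fin m, |x i.succ| ≤ B) ∧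
        x 0 = dd) ∧ 0 < h.realize (Sum.elim a x)) ∧
        (fullDetT c h).realize (Sum.elim a x) * (tailDetT c).realize (Sum.elim a x) < 0}.encard +
    {x : Fin (m + 1) → M | ((((∀ i, (c i).realize (Sum.elim a x) = 0) ∧ ∀ i : Fin m, |x i.succ| ≤ B) ∧
        x 0 = dd) ∧ h.realize (Sum.elim a x) < 0) ∧
        0 < (fullDetT c h).realize (Sum.elim a x) * (tailDetT c).realize (Sum.elim a x)}.encard = r

/-- Realization of `lemma6F`. [folklore] -/
theorem realize_lemma6F (c : Fin m → Language.orderedExpRing.Term (κ ⊕ Fin (m + 1)))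
    (h : Language.orderedExpRing.Term (κ ⊕ Fin (m + 1))) (r : ℕ) (v : κ ⊕ Fin 3 → M) :
    (lemma6F c h r).Realize v ↔
      Lemma6Sem c h (v ∘ Sum.inl) (v (Sum.inr 0)) (v (Sum.inr 1)) (v (Sum.inr 2)) r := by
  simp only [lemma6F, Lemma6Sem, Formula.realize_imp, Formula.realize_inf, Formula.realize_iAlls,
    Formula.realize_iff, Formula.realize_not, realize_sumCardF_five, realize_exactCardF, realize_inVF,
    realize_tailLeF, realize_tailLtF, realize_atPt, ExpFormula.realize_lt, ExpFormula.realize_le,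
    ExpFormula.realize_eq, ExpTerm.realize_zero, ExpTerm.realize_one, ExpTerm.realize_mul,
    ExpTerm.realize_add, Term.realize_var, Term.realize_relabel, Sum.elim_inr,
    Sum.elim_comp_inl, elim_comp_inl_comp,
    Fin.forall_fin_succ_pi, Fin.forall_fin_zero_pi, Fin.cons_zero, Fin.cons_succ]

/-! ### The real side: from the analytic Lemma 6 -/

section Real

open SpaceCurve

/-- Membership in `Ū_b` in coordinates. [folklore] -/
theorem mem_closure_box_iff_abs_le {b : ℝ} (hb : 0 < b) (y : Fin m → ℝ) :
    y ∈ closure (box b) ↔ ∀ i, |y i| ≤ b := by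
  rw [mem_closure_box_iff_norm_le hb, pi_norm_le_iff_of_nonneg hb.le]
  simp [Real.norm_eq_abs]

/-- `Ū_B ⊆ Ū_{B+1}` fibrewise. [folklore] -/
theorem fibre_closure_box_mono {V : Set (Fin (m + 1) → ℝ)} {a B : ℝ} (hB : 0 < B) :
    fibre V a (closure (box B)) ⊆ fibre V a (closure (box (B + 1))) := by
  rintro x ⟨hV, h0, htail⟩
  refine ⟨hV, h0, ?_⟩
  rw [mem_closure_box_iff_abs_le hB] at htail
  rw [mem_closure_box_iff_abs_le (by linarith)]
  exact fun i => (htail i).trans (by linarith)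

variable (c : Fin m → Language.orderedExpRing.Term (κ ⊕ Fin (m + 1)))
  (h : Language.orderedExpRing.Term (κ ⊕ Fin (m + 1))) (a : κ → ℝ)

/-- The functions `ℝ^{m+1} → ℝ` defined by the curve terms at the parameters `a`. [folklore] -/
def sysFn : Fin m → (Fin (m + 1) → ℝ) → ℝ := fun i x => (c i).realize (Sum.elim a x)

/-- The function defined by `h`. [folklore] -/
def hFn : (Fin (m + 1) → ℝ) → ℝ := fun x => h.realize (Sum.elim a x)

/-- The term functions are `C¹`. [folklore] -/
theorem contDiff_sysFn (i : Fin m) : ContDiff ℝ 1 (sysFn c a i) := contDiff_realize (c i) a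

/-- The tail Jacobian of the term functions is the realization of `tailDetT`. [folklore] -/
theorem det_tailJacobian_sysFn (x : Fin (m + 1) → ℝ) :
    (tailJacobian (sysFn c a) x).det = (tailDetT c).realize (Sum.elim a x) := by
  rw [tailDetT, ExpTerm.realize_det]
  congr 1
  ext i j
  simp only [tailJacobian, Matrix.of_apply, Matrix.map_apply]
  exact fderiv_realize_single (c i) a x j.succ

/-- The full Jacobian of the term functions is the realization of `fullDetT`. [folklore] -/
theorem det_fullJacobian_sysFn (x : Fin (m + 1) → ℝ) :
    (fullJacobian (sysFn c a) (hFn h a) x).det = (fullDetT c h).realize (Sum.elim a x) := by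
  rw [fullDetT, ExpTerm.realize_det]
  congr 1
  ext i j
  refine Fin.cases ?_ (fun i => ?_) i
  · simp only [fullJacobian, Matrix.of_apply, Matrix.map_apply, Fin.cons_zero]
    exact fderiv_realize_single h a x j
  · simp only [fullJacobian, Matrix.of_apply, Matrix.map_apply, Fin.cons_succ]
    exact fderiv_realize_single (c i) a x j

/-- Sign of a quotient versus sign of a product. [folklore] -/
theorem pos_mul_inv_iff {u w : ℝ} (hw : w ≠ 0) : 0 < u * w⁻¹ ↔ 0 < u * w := by
  rcases lt_or_gt_of_ne hw with hlt | hgt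
  · rw [mul_pos_iff, mul_pos_iff]; simp [inv_pos, hlt, not_lt.2 hlt.le]
  · rw [mul_pos_iff, mul_pos_iff]; simp [inv_pos, hgt, not_lt.2 hgt.le]

/-- Sign of a quotient versus sign of a product. [folklore] -/
theorem neg_mul_inv_iff {u w : ℝ} (hw : w ≠ 0) : u * w⁻¹ < 0 ↔ u * w < 0 := by
  rcases lt_or_gt_of_ne hw with hlt | hgt
  · rw [mul_neg_iff, mul_neg_iff]; simp [inv_pos, hlt, not_lt.2 hlt.le]
  · rw [mul_neg_iff, mul_neg_iff]; simp [inv_pos, hgt, not_lt.2 hgt.le]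

/-- **Lemma 6 holds in `ℝ` in the first-order form** (from `Wilkie1989_lemma6`). [cite: Wilkie1989, §5, p. 403] -/
theorem lemma6Sem_real (B cc dd : ℝ) (r : ℕ) : Lemma6Sem c h a B cc dd r := by
  rintro ⟨⟨⟨⟨h1, hB, hcd⟩, h3⟩, h4⟩, h5⟩
  set g := sysFn c a with hg'
  set hh := hFn h a with hh'
  have hg : ∀ i, ContDiff ℝ 1 (g i) := contDiff_sysFn c a
  have hV : ∀ x, x ∈ zeroLocus g ↔ ∀ i, (c i).realize (Sum.elim a x) = 0 := fun x => Iff.rfl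
  have hdetV : ∀ x ∈ zeroLocus g, (tailJacobian g x).det ≠ 0 := by
    intro x hx
    rw [det_tailJacobian_sysFn]
    have := h1 (x 0) (Fin.tail x) (by rw [Fin.cons_self_tail]; exact hx)
    rwa [Fin.cons_self_tail] at this
  have hdetF : ∀ x ∈ zeroLocus g, (fullDetT c h).realize (Sum.elim a x) ≠ 0 := by
    intro x hx
    have := h5 (x 0) (Fin.tail x) (by rw [Fin.cons_self_tail]; exact hx)
    rwa [Fin.cons_self_tail] at this
  have hcl : ∀ {b : ℝ}, 0 < b → ∀ y : Fin m → ℝ, y ∈ closure (box b) ↔ ∀ i, |y i| ≤ b :=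
    fun hb y => mem_closure_box_iff_abs_le hb y
  have H1 : ∀ t ∈ Icc cc dd, (fibre (zeroLocus g) t (closure (box B))).encard = r := by
    intro t ht
    rw [← h3 t ht]
    congr 1
    ext x
    simp only [mem_fibre, hV, hcl hB, mem_setOf_eq, Fin.tail]
    tauto
  have H2 : ∀ t ∈ Ioo cc dd, fibre (zeroLocus g) t (box B) = fibre (zeroLocus g) t (closure (box (B + 1))) := by
    intro t ht
    ext x
    simp only [mem_fibre, mem_box, hcl (by linarith : (0:ℝ) < B + 1), Fin.tail]
    constructor
    · rintro ⟨hx, hx0, hb⟩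
      exact ⟨hx, hx0, (h4 t ht (x 0) (Fin.tail x) ⟨by rw [Fin.cons_self_tail]; exact hx, hx0⟩).1 hb⟩
    · rintro ⟨hx, hx0, hb⟩
      exact ⟨hx, hx0, (h4 t ht (x 0) (Fin.tail x) ⟨by rw [Fin.cons_self_tail]; exact hx, hx0⟩).2 hb⟩
  have hhC : ContDiff ℝ 1 hh := contDiff_realize h a
  have hgs : ∀ x ∈ zeroLocus g, gStar g hh x =
      (fullDetT c h).realize (Sum.elim a x) * ((tailDetT c).realize (Sum.elim a x))⁻¹ := by
    intro x _
    rw [gStar, det_fullJacobian_sysFn, det_tailJacobian_sysFn]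
  have hstar : ∀ x ∈ zeroLocus g, gStar g hh x ≠ 0 := by
    intro x hx
    rw [hgs x hx]
    exact mul_ne_zero (hdetF x hx) (inv_ne_zero (by rw [← det_tailJacobian_sysFn]; exact hdetV x hx))
  have hbox : ∀ t ∈ Ioo cc dd, fibre (zeroLocus g) t (closure (box B)) ⊆ fibre (zeroLocus g) t (box B) :=
    fun t ht x hx => by rw [H2 t ht]; exact fibre_closure_box_mono hB hx
  have key := Wilkie1989_lemma6 hg hdetV hhC hB hcd H1 hbox (fun x hx _ _ => hstar x hx)
  -- identify the five sets
  have hpos : ∀ x ∈ zeroLocus g, (0 < gStar g hh x ↔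
      0 < (fullDetT c h).realize (Sum.elim a x) * (tailDetT c).realize (Sum.elim a x)) := by
    intro x hx
    rw [hgs x hx]
    exact pos_mul_inv_iff (by rw [← det_tailJacobian_sysFn]; exact hdetV x hx)
  have hneg : ∀ x ∈ zeroLocus g, (gStar g hh x < 0 ↔
      (fullDetT c h).realize (Sum.elim a x) * (tailDetT c).realize (Sum.elim a x) < 0) := by
    intro x hx
    rw [hgs x hx]
    exact neg_mul_inv_iff (by rw [← det_tailJacobian_sysFn]; exact hdetV x hx)
  have hhx : ∀ x, hh x = h.realize (Sum.elim a x) := fun x => rfl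
  have eZ : {x | x ∈ zeroLocus g ∧ x 0 ∈ Icc cc dd ∧ Fin.tail x ∈ closure (box B) ∧ hh x = 0} =
      {x : Fin (m + 1) → ℝ | ((((∀ i, (c i).realize (Sum.elim a x) = 0) ∧ ∀ i : Fin m, |x i.succ| ≤ B) ∧
        cc ≤ x 0) ∧ x 0 ≤ dd) ∧ h.realize (Sum.elim a x) = 0} := by
    ext x
    simp only [mem_setOf_eq, hV, mem_Icc, hcl hB, hhx, Fin.tail]
    tauto
  have eS : ∀ (e : ℝ) (P Q : ℝ → Prop),
      (∀ x ∈ zeroLocus g, (P (gStar g hh x) ↔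
        Q ((fullDetT c h).realize (Sum.elim a x) * (tailDetT c).realize (Sum.elim a x)))) →
      ∀ (R : ℝ → Prop),
      {x | x ∈ fibre (zeroLocus g) e (closure (box B)) ∧ R (hh x) ∧ P (gStar g hh x)} =
        {x : Fin (m + 1) → ℝ | ((((∀ i, (c i).realize (Sum.elim a x) = 0) ∧ ∀ i : Fin m, |x i.succ| ≤ B) ∧
          x 0 = e) ∧ R (h.realize (Sum.elim a x))) ∧
          Q ((fullDetT c h).realize (Sum.elim a x) * (tailDetT c).realize (Sum.elim a x))} := by
    intro e P Q hPQ R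
    ext x
    simp only [mem_setOf_eq, mem_fibre, hcl hB, hhx, Fin.tail]
    constructor
    · rintro ⟨⟨hx, hx0, hb⟩, hR, hP⟩
      exact ⟨⟨⟨⟨hx, hb⟩, hx0⟩, hR⟩, (hPQ x hx).1 hP⟩
    · rintro ⟨⟨⟨⟨hx, hb⟩, hx0⟩, hR⟩, hQ⟩
      exact ⟨⟨hx, hx0, hb⟩, hR, (hPQ x hx).2 hQ⟩
  rw [eZ, eS cc (fun u => 0 < u) (fun u => 0 < u) hpos (fun u => 0 < u),
    eS cc (fun u => u < 0) (fun u => u < 0) hneg (fun u => u < 0),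
    eS dd (fun u => u < 0) (fun u => u < 0) hneg (fun u => 0 < u),
    eS dd (fun u => 0 < u) (fun u => 0 < u) hpos (fun u => u < 0)] at key
  exact key

end Real

/-! ### Transfer to the models of `T_exp` -/

/-- **Lemma 6 in every model of `T_exp`** ("using transfer", pp. 403, 407): for terms
`c₁, …, cₘ, h` with parameters from `K` and `B, c, d ∈ K`, the first-order content of Lemma 6
holds in `K`. [cite: Wilkie1989, §5, p. 403] -/
theorem lemma6Sem_model (K : Language.Theory.ModelType.{0, 0, 0} realExpTheory)
    (c : Fin m → Language.orderedExpRing.Term (κ ⊕ Fin (m + 1)))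
    (h : Language.orderedExpRing.Term (κ ⊕ Fin (m + 1))) (a : κ → K) (B cc dd : K) (r : ℕ) :
    Lemma6Sem c h a B cc dd r := by
  have hreal : ∀ v : κ ⊕ Fin 3 → ℝ, (lemma6F c h r).Realize v := fun v =>
    (realize_lemma6F c h r v).2 (lemma6Sem_real c h _ _ _ _ r)
  have := realize_formula_of_real K (lemma6F c h r) hreal (Sum.elim a ![B, cc, dd])
  rw [realize_lemma6F] at this
  simpa using this

end Lemma6F

/-! ### Lemma 4 as a first-order formula -/

section Lemma4F

/-- "all coordinates of the point have absolute value `< B`" (`‖x‖ < B`). [folklore] -/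
def allLtF (B : Language.orderedExpRing.Term W) : Language.orderedExpRing.Formula (W ⊕ Fin (m + 1)) :=
  Formula.iInf fun i : Fin (m + 1) => absLtF (var (Sum.inr i)) (B.relabel Sum.inl)

/-- "some coordinate has absolute value `> B`" (`B < ‖x‖`). [folklore] -/
def someGtF (B : Language.orderedExpRing.Term W) : Language.orderedExpRing.Formula (W ⊕ Fin (m + 1)) :=
  Formula.iSup fun i : Fin (m + 1) => absGtF (B.relabel Sum.inl) (var (Sum.inr i))

/-- "`‖x‖ = B`": all coordinates `≤ B` in absolute value and one of them `= ±B`. [folklore] -/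
def normEqF (B : Language.orderedExpRing.Term W) : Language.orderedExpRing.Formula (W ⊕ Fin (m + 1)) :=
  (Formula.iInf fun i : Fin (m + 1) => absLeF (var (Sum.inr i)) (B.relabel Sum.inl)) ⊓
    Formula.iSup fun i : Fin (m + 1) => absEqF (var (Sum.inr i)) (B.relabel Sum.inl)

/-- Realization of `allLtF`. [folklore] -/
@[simp] theorem realize_allLtF (B : Language.orderedExpRing.Term W) (w : W → M) (x : Fin (m + 1) → M) :
    (allLtF (m := m) B).Realize (Sum.elim w x) ↔ ∀ i : Fin (m + 1), |x i| < B.realize w := by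
  simp [allLtF]

omit [IsStrictOrderedRing M] in
/-- Realization of `someGtF`. [folklore] -/
@[simp] theorem realize_someGtF (B : Language.orderedExpRing.Term W) (w : W → M) (x : Fin (m + 1) → M) :
    (someGtF (m := m) B).Realize (Sum.elim w x) ↔ ∃ i : Fin (m + 1), B.realize w < |x i| := by
  simp [someGtF]

/-- Realization of `normEqF`. [folklore] -/
@[simp] theorem realize_normEqF (B : Language.orderedExpRing.Term W) (w : W → M) (x : Fin (m + 1) → M) :
    (normEqF (m := m) B).Realize (Sum.elim w x) ↔
      (∀ i : Fin (m + 1), |x i| ≤ B.realize w) ∧ ∃ i : Fin (m + 1), x i = B.realize w ∨ x i = -B.realize w := by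
  simp [normEqF]

/-- **Lemma 4 as a first-order formula** in the parameters `κ` of the terms and the two real
quantities `B, β₁` (free variables `Fin 2`): hypotheses "tail determinant non-vanishing on `V`",
"`0 < B`, `|β₁| < B`", "`V ∩ ({β₁} × U_B) = V ∩ ({β₁} × Ū_{B+1})`", "exactly `r` points in it";
conclusion "there are `c, d` with `-B ≤ c < β₁ < d ≤ B`, exactly `r` points over every `a ∈ [c, d]`
inside `Ū_B`, a point of sup norm `B` or `B + 1` over `c` and over `d`, and over `a ∈ (c, d)` every
point of `V` has sup norm `< B` or `> B + 1`" (p. 403). [cite: Wilkie1989, §5, p. 403] -/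
def lemma4F (c : Fin m → Language.orderedExpRing.Term (κ ⊕ Fin (m + 1))) (r : ℕ) :
    Language.orderedExpRing.Formula (κ ⊕ Fin 2) :=
  let W := κ ⊕ Fin 2
  let ι : κ → W := Sum.inl
  let B : Language.orderedExpRing.Term W := var (Sum.inr 0)
  let β : Language.orderedExpRing.Term W := var (Sum.inr 1)
  let hyp1 : Language.orderedExpRing.Formula W :=
    Formula.iAlls (Fin (m + 1)) (inVF ι c ⟹ (ExpFormula.eq (atPt ι (tailDetT c)) 0).not)
  let hyp2 : Language.orderedExpRing.Formula W := ExpFormula.lt 0 B ⊓ absLtF β B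
  let hyp3 : Language.orderedExpRing.Formula W :=
    Formula.iAlls (Fin (m + 1))
      ((inVF ι c ⊓ ExpFormula.eq (var (Sum.inr 0)) (β.relabel Sum.inl)) ⟹ (tailLtF B ⇔ tailLeF (B + 1)))
  let hyp4 : Language.orderedExpRing.Formula W :=
    exactCardF (inVF ι c ⊓ ExpFormula.eq (var (Sum.inr 0)) (β.relabel Sum.inl) ⊓ tailLtF B) r
  -- conclusion, in the context `W₂ = W ⊕ Fin 2` of `c, d`
  let W₂ := W ⊕ Fin 2
  let ι₂ : κ → W₂ := Sum.inl ∘ Sum.inl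
  let B₂ : Language.orderedExpRing.Term W₂ := B.relabel Sum.inl
  let β₂ : Language.orderedExpRing.Term W₂ := β.relabel Sum.inl
  let cc : Language.orderedExpRing.Term W₂ := var (Sum.inr 0)
  let dd : Language.orderedExpRing.Term W₂ := var (Sum.inr 1)
  let ineq : Language.orderedExpRing.Formula W₂ :=
    (ExpFormula.le (-B₂) cc ⊓ ExpFormula.lt cc β₂) ⊓ (ExpFormula.lt β₂ dd ⊓ ExpFormula.le dd B₂)
  -- counts over `a ∈ [c, d]`, context `W₃ = W₂ ⊕ Fin 1`
  let W₃ := W₂ ⊕ Fin 1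
  let ι₃ : κ → W₃ := Sum.inl ∘ ι₂
  let a : Language.orderedExpRing.Term W₃ := var (Sum.inr 0)
  let counts : Language.orderedExpRing.Formula W₂ :=
    Formula.iAlls (Fin 1)
      ((ExpFormula.le (cc.relabel Sum.inl) a ⊓ ExpFormula.le a (dd.relabel Sum.inl)) ⟹
        exactCardF (inVF ι₃ c ⊓ ExpFormula.eq (var (Sum.inr 0)) (a.relabel Sum.inl) ⊓
          tailLeF (B₂.relabel Sum.inl)) r)
  let endpt : Language.orderedExpRing.Term W₂ → Language.orderedExpRing.Formula W₂ := fun e =>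
    Formula.iExs (Fin (m + 1))
      (inVF ι₂ c ⊓ ExpFormula.eq (var (Sum.inr 0)) (e.relabel Sum.inl) ⊓ (normEqF B₂ ⊔ normEqF (B₂ + 1)))
  let interior : Language.orderedExpRing.Formula W₂ :=
    Formula.iAlls (Fin 1)
      ((ExpFormula.lt (cc.relabel Sum.inl) a ⊓ ExpFormula.lt a (dd.relabel Sum.inl)) ⟹
        Formula.iAlls (Fin (m + 1))
          ((inVF ι₃ c ⊓ ExpFormula.eq (var (Sum.inr 0)) (a.relabel Sum.inl)) ⟹
            (allLtF (B₂.relabel Sum.inl) ⊔ someGtF (B₂.relabel Sum.inl + 1))))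
  (hyp1 ⊓ hyp2 ⊓ hyp3 ⊓ hyp4) ⟹
    Formula.iExs (Fin 2) (ineq ⊓ counts ⊓ endpt cc ⊓ endpt dd ⊓ interior)

/-- **The semantic content of `lemma4F`** in a lawful ordered structure `M` (parameters `a`,
quantities `B, β₁`): Lemma 4 for the functions defined by the terms (shape produced by unfolding
the formula, `realize_lemma4F`). [cite: Wilkie1989, §5, p. 403] -/
def Lemma4Sem (c : Fin m → Language.orderedExpRing.Term (κ ⊕ Fin (m + 1))) (a : κ → M) (B β : M)
    (r : ℕ) : Prop :=
  ((((∀ (t : M) (y : Fin m → M), (∀ i, (c i).realize (Sum.elim a (Fin.cons t y)) = 0) →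
            ¬ (tailDetT c).realize (Sum.elim a (Fin.cons t y)) = 0) ∧
          0 < B ∧ |β| < B) ∧
        ∀ (t : M) (y : Fin m → M),
          (∀ i, (c i).realize (Sum.elim a (Fin.cons t y)) = 0) ∧ t = β →
            ((∀ i : Fin m, |y i| < B) ↔ ∀ i : Fin m, |y i| ≤ B + 1)) ∧
      {x : Fin (m + 1) → M | ((∀ i, (c i).realize (Sum.elim a x) = 0) ∧ x 0 = β) ∧
        ∀ i : Fin m, |x i.succ| < B}.encard = r) →
    ∃ cc dd : M,
      (((((-B ≤ cc ∧ cc < β) ∧ β < dd ∧ dd ≤ B) ∧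
              ∀ t : M, cc ≤ t ∧ t ≤ dd →
                {x : Fin (m + 1) → M | ((∀ i, (c i).realize (Sum.elim a x) = 0) ∧ x 0 = t) ∧
                  ∀ i : Fin m, |x i.succ| ≤ B}.encard = r) ∧
            ∃ (t : M) (y : Fin m → M),
              ((∀ i, (c i).realize (Sum.elim a (Fin.cons t y)) = 0) ∧ t = cc) ∧
                (((∀ i : Fin (m + 1), |(Fin.cons t y : Fin (m + 1) → M) i| ≤ B) ∧
                    ∃ i : Fin (m + 1), (Fin.cons t y : Fin (m + 1) → M) i = B ∨
                      (Fin.cons t y : Fin (m + 1) → M) i = -B) ∨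
                  (∀ i : Fin (m + 1), |(Fin.cons t y : Fin (m + 1) → M) i| ≤ B + 1) ∧
                    ∃ i : Fin (m + 1), (Fin.cons t y : Fin (m + 1) → M) i = B + 1 ∨
                      (Fin.cons t y : Fin (m + 1) → M) i = -(B + 1))) ∧
          ∃ (t : M) (y : Fin m → M),
            ((∀ i, (c i).realize (Sum.elim a (Fin.cons t y)) = 0) ∧ t = dd) ∧
              (((∀ i : Fin (m + 1), |(Fin.cons t y : Fin (m + 1) → M) i| ≤ B) ∧
                  ∃ i : Fin (m + 1), (Fin.cons t y : Fin (m + 1) → M) i = B ∨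
                    (Fin.cons t y : Fin (m + 1) → M) i = -B) ∨
                (∀ i : Fin (m + 1), |(Fin.cons t y : Fin (m + 1) → M) i| ≤ B + 1) ∧
                  ∃ i : Fin (m + 1), (Fin.cons t y : Fin (m + 1) → M) i = B + 1 ∨
                    (Fin.cons t y : Fin (m + 1) → M) i = -(B + 1))) ∧
        ∀ s : M, cc < s ∧ s < dd → ∀ (t : M) (y : Fin m → M),
          (∀ i, (c i).realize (Sum.elim a (Fin.cons t y)) = 0) ∧ t = s →
            (∀ i : Fin (m + 1), |(Fin.cons t y : Fin (m + 1) → M) i| < B) ∨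
              ∃ i : Fin (m + 1), B + 1 < |(Fin.cons t y : Fin (m + 1) → M) i|

/-- Realization of `lemma4F`. [folklore] -/
theorem realize_lemma4F (c : Fin m → Language.orderedExpRing.Term (κ ⊕ Fin (m + 1))) (r : ℕ)
    (v : κ ⊕ Fin 2 → M) :
    (lemma4F c r).Realize v ↔ Lemma4Sem c (v ∘ Sum.inl) (v (Sum.inr 0)) (v (Sum.inr 1)) r := by
  simp only [lemma4F, Lemma4Sem, Formula.realize_imp, Formula.realize_inf, Formula.realize_sup,
    Formula.realize_iAlls, Formula.realize_iExs, Formula.realize_iff, Formula.realize_not,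
    realize_exactCardF, realize_inVF, realize_tailLeF, realize_tailLtF, realize_allLtF, realize_someGtF,
    realize_normEqF, realize_absLtF, realize_atPt, ExpFormula.realize_lt, ExpFormula.realize_le,
    ExpFormula.realize_eq, ExpTerm.realize_zero, ExpTerm.realize_one,
    ExpTerm.realize_add, ExpTerm.realize_neg, Term.realize_var, Term.realize_relabel, Sum.elim_inr,
    Sum.elim_comp_inl, elim_comp_inl_comp,
    Fin.forall_fin_succ_pi, Fin.forall_fin_zero_pi, Fin.exists_fin_succ_pi, Fin.exists_fin_zero_pi,
    Fin.cons_zero, Fin.cons_succ, Fin.cons_one]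

section Real

open SpaceCurve

/-- `‖x‖ = B` in coordinates (for `B ≥ 0`, one direction). [folklore] -/
theorem abs_le_and_exists_of_norm_eq {x : Fin (m + 1) → ℝ} {B : ℝ} (h : ‖x‖ = B) :
    (∀ i, |x i| ≤ B) ∧ ∃ i, x i = B ∨ x i = -B := by
  refine ⟨fun i => ?_, ?_⟩
  · rw [← h, ← Real.norm_eq_abs]; exact norm_le_pi_norm x i
  · rw [norm_eq_sup'_abs] at h
    obtain ⟨i, -, hi⟩ := Finset.exists_mem_eq_sup' (s := Finset.univ) Finset.univ_nonempty fun i => |x i|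
    refine ⟨i, ?_⟩
    rw [hi] at h
    rcases abs_eq_abs.1 (h.trans (abs_of_nonneg (h ▸ abs_nonneg (x i))).symm) with h' | h'
    · exact Or.inl h'
    · exact Or.inr h'

/-- **Lemma 4 holds in `ℝ` in the first-order form** (from `Wilkie1989_lemma4`). [cite: Wilkie1989, §5, p. 403] -/
theorem lemma4Sem_real (c : Fin m → Language.orderedExpRing.Term (κ ⊕ Fin (m + 1))) (a : κ → ℝ)
    (B β : ℝ) {r : ℕ} (hr : 1 ≤ r) : Lemma4Sem c a B β r := by
  rintro ⟨⟨⟨h1, hB, hβ⟩, h3⟩, h4⟩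
  set g := sysFn c a with hg'
  have hg : ∀ i, ContDiff ℝ 1 (g i) := contDiff_sysFn c a
  have hV : ∀ x, x ∈ zeroLocus g ↔ ∀ i, (c i).realize (Sum.elim a x) = 0 := fun x => Iff.rfl
  have hdetV : ∀ x ∈ zeroLocus g, (tailJacobian g x).det ≠ 0 := by
    intro x hx
    rw [det_tailJacobian_sysFn]
    have := h1 (x 0) (Fin.tail x) (by rw [Fin.cons_self_tail]; exact hx)
    rwa [Fin.cons_self_tail] at this
  have hcl : ∀ {b : ℝ}, 0 < b → ∀ y : Fin m → ℝ, y ∈ closure (box b) ↔ ∀ i, |y i| ≤ b :=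
    fun hb y => mem_closure_box_iff_abs_le hb y
  have hEq : fibre (zeroLocus g) β (box B) = fibre (zeroLocus g) β (closure (box (B + 1))) := by
    ext x
    simp only [mem_fibre, mem_box, hcl (by linarith : (0:ℝ) < B + 1), Fin.tail]
    constructor
    · rintro ⟨hx, hx0, hb⟩
      exact ⟨hx, hx0, (h3 (x 0) (Fin.tail x) ⟨by rw [Fin.cons_self_tail]; exact hx, hx0⟩).1 hb⟩
    · rintro ⟨hx, hx0, hb⟩
      exact ⟨hx, hx0, (h3 (x 0) (Fin.tail x) ⟨by rw [Fin.cons_self_tail]; exact hx, hx0⟩).2 hb⟩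
  have hcount : (fibre (zeroLocus g) β (box B)).encard = r := by
    rw [← h4]
    congr 1
    ext x
    simp only [mem_fibre, hV, mem_box, mem_setOf_eq, Fin.tail]
    tauto
  obtain ⟨cc, dd, hcB, hcβ, hβd, hdB, hcounts, hend, hint⟩ :=
    Wilkie1989_lemma4 hg hdetV hB hβ hr hEq.symm.subset hcount
  -- conversions of the conclusions
  have hnormcases : ∀ x : Fin (m + 1) → ℝ, (‖x‖ = B ∨ ‖x‖ = B + 1) →
      (((∀ i, |x i| ≤ B) ∧ ∃ i, x i = B ∨ x i = -B) ∨
        ((∀ i, |x i| ≤ B + 1) ∧ ∃ i, x i = B + 1 ∨ x i = -(B + 1))) := by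
    rintro x (hx | hx)
    · exact Or.inl (abs_le_and_exists_of_norm_eq hx)
    · exact Or.inr (abs_le_and_exists_of_norm_eq hx)
  have hendpt : ∀ e, (∃ x ∈ zeroLocus g, x 0 = e ∧ (‖x‖ = B ∨ ‖x‖ = B + 1)) →
      ∃ (t : ℝ) (y : Fin m → ℝ), ((∀ i, (c i).realize (Sum.elim a (Fin.cons t y)) = 0) ∧ t = e) ∧
        (((∀ i : Fin (m + 1), |(Fin.cons t y : Fin (m + 1) → ℝ) i| ≤ B) ∧
            ∃ i : Fin (m + 1), (Fin.cons t y : Fin (m + 1) → ℝ) i = B ∨ (Fin.cons t y : Fin (m + 1) → ℝ) i = -B) ∨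
          (∀ i : Fin (m + 1), |(Fin.cons t y : Fin (m + 1) → ℝ) i| ≤ B + 1) ∧
            ∃ i : Fin (m + 1), (Fin.cons t y : Fin (m + 1) → ℝ) i = B + 1 ∨
              (Fin.cons t y : Fin (m + 1) → ℝ) i = -(B + 1)) := by
    rintro e ⟨x, hx, hx0, hxn⟩
    refine ⟨x 0, Fin.tail x, ?_, ?_⟩
    · rw [Fin.cons_self_tail]; exact ⟨hx, hx0⟩
    · rw [Fin.cons_self_tail]; exact hnormcases x hxn
  refine ⟨cc, dd, ⟨⟨⟨⟨⟨hcB, hcβ⟩, hβd, hdB⟩, fun t ht => ?_⟩, hendpt cc (hend cc (Or.inl rfl))⟩,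
    hendpt dd (hend dd (Or.inr rfl))⟩, fun s hs t y hty => ?_⟩
  · rw [← hcounts t ht]
    congr 1
    ext x
    simp only [mem_fibre, hV, hcl hB, mem_setOf_eq, Fin.tail]
    tauto
  · obtain ⟨hy, rfl⟩ := hty
    rcases hint t hs _ hy rfl with hlt | hgt
    · left
      intro i
      rw [← Real.norm_eq_abs]
      exact lt_of_le_of_lt (norm_le_pi_norm _ i) hlt
    · right
      rw [norm_eq_sup'_abs, Finset.lt_sup'_iff] at hgt
      obtain ⟨i, -, hi⟩ := hgt
      exact ⟨i, hi⟩

end Real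

/-- **Lemma 4 in every model of `T_exp`** ("We are now in a position to apply Lemma 4 (using
transfer …)", p. 405): for terms `c₁, …, cₘ` with parameters from `K`, `B, β₁ ∈ K` and `r ≥ 1`, the
first-order content of Lemma 4 holds in `K`. [cite: Wilkie1989, §6, p. 405] -/
theorem lemma4Sem_model (K : Language.Theory.ModelType.{0, 0, 0} realExpTheory)
    (c : Fin m → Language.orderedExpRing.Term (κ ⊕ Fin (m + 1))) (a : κ → K) (B β : K) {r : ℕ}
    (hr : 1 ≤ r) : Lemma4Sem c a B β r := by
  have hreal : ∀ v : κ ⊕ Fin 2 → ℝ, (lemma4F c r).Realize v := fun v =>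
    (realize_lemma4F c r v).2 (lemma4Sem_real c _ _ _ hr)
  have := realize_formula_of_real K (lemma4F c r) hreal (Sum.elim a ![B, β])
  rw [realize_lemma4F] at this
  simpa using this

end Lemma4F

end CurveTransfer

end Literature.ModelTheory.ExponentialFields
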